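import Summits.Ventures.PercRepro.RankLevelSetContractMonoCore

/-!
# PercRepro — C-025 from the TWO-CELL contraction monotonicity of the slack (night-1, gen 8; C-037 weakened)

g7's (MC) `σ_{M／e}(p−1, q) ≤ σ_M(p, q)` is FALSE at a point of a 6-point line next to free pieces (census), and
its diagonal twin `σ_{M／e}(p−1, q−1) ≤ σ_M(p, q)` is false on the tight layer (`U_{p,p+q}`: `σ_M = 0`, the
contraction is not tight at `(p−1, q−1)`).  The two fail in different places; their MINIMUM survives everything:

  **(MC-2)** `ContractMonoTwo` — for every finite matroid `M`, every non-loop `e`, every `q ≥ 1`, `q + 2 ≤ p`: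
  `min(σ_{M／e}(p−1, q), σ_{M／e}(p−1, q−1)) ≤ σ_M(p, q)`

(night-1 g8 census, mining/night-1/g8/: every non-loop element of EVERY matroid with ≤ 9 elements at every cell
`q + 2 ≤ p ≤ ρ(M)` — 0 failures in 8,680,532 instances at 9 elements; truncated direct sums of ≤ 3 uniform pieces with ≤ 17
elements, every cell including the tight layer: 0 failures where (MC) fails 24 times; the named matroids
`PG(3,2)`, `AG(3,2)`, `R10`, `M(K₅)`, `M(K₆)`, `M(K_{3,3})`, the Wagner and Petersen graphs: 0 failures).

* `ContractMonoTwoExists` — (MC-2) at SOME non-loop of every matroid with a non-loop;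
* **`c025_of_contractMonoTwoExists`** — (MC-2)∃ → C025: strong induction on `|E|` for all cells at once;
  the two cells `(p−1, q)`, `(p−1, q−1)` of the contraction are the induction hypothesis (`(q, q−1)`-type
  trivial cells have `σ = 0`, `q − 1 = 0` is Theorem A);
* `c025_of_contractMonoTwo` — the every-element form.

(MC-2) is implied by (MC) (`contractMonoTwo_of_contractMono`) and by the ordered certificate
(RankLevelSetOrderedCore: it is the first chain term of (OC-EXT-∀) without the independent-set option).
Axioms: standard.
-/

open scoped Matroid

namespace PercRepro

namespace Matroid

open Set

variable {α : Type}

/-- **(MC-2)** at every non-loop: `min(σ_{M／e}(p−1, q), σ_{M／e}(p−1, q−1)) ≤ σ_M(p, q)` for `1 ≤ q`, `q + 2 ≤ p`. -/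
def ContractMonoTwo : Prop :=
  ∀ {α : Type} (M : _root_.Matroid α) [M.Finite] (p q : ℕ), 1 ≤ q → q + 2 ≤ p →
    ∀ e, M.IsNonloop e → min (slack (M ／ {e}) (p - 1) q) (slack (M ／ {e}) (p - 1) (q - 1)) ≤ slack M p q

/-- **(MC-2)∃**: some non-loop `e` of every finite matroid with a non-loop satisfies the two-cell monotonicity. -/
def ContractMonoTwoExists : Prop :=
  ∀ {α : Type} (M : _root_.Matroid α) [M.Finite] (p q : ℕ), 1 ≤ q → q + 2 ≤ p →
    (∃ e, M.IsNonloop e) →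
    ∃ e, M.IsNonloop e ∧ min (slack (M ／ {e}) (p - 1) q) (slack (M ／ {e}) (p - 1) (q - 1)) ≤ slack M p q

/-- (MC) implies (MC-2). -/
theorem contractMonoTwo_of_contractMono (h : ContractMono) : ContractMonoTwo := by
  intro α M _ p q _ hpq e he
  exact le_trans (min_le_left _ _) (h M p q hpq e he)

/-- (MC-2) implies (MC-2)∃. -/
theorem contractMonoTwoExists_of_contractMonoTwo (h : ContractMonoTwo) : ContractMonoTwoExists := by
  intro α M _ p q hq hpq ⟨e, he⟩
  exact ⟨e, he, h M p q hq hpq e he⟩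

/-- The slack at `(p, 0)` is nonnegative: Theorem A (`c025_of_q_zero`). -/
theorem slack_nonneg_q_zero (M : _root_.Matroid α) [M.Finite] (p : ℕ) : 0 ≤ slack M p 0 := by
  rw [← ThmN.RLS_iff_slack_nonneg]
  exact c025_of_q_zero (M := M) p

/-- The induction: under (MC-2)∃, `σ_M(p, q) ≥ 0` for every finite matroid and every `q + 2 ≤ p`. -/
theorem slack_nonneg_of_contractMonoTwoExists (h : ContractMonoTwoExists) :
    ∀ (n : ℕ) {α : Type} (M : _root_.Matroid α) [M.Finite], M.E.ncard = n →
      ∀ (p q : ℕ), q + 2 ≤ p → 0 ≤ slack M p q := by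
  intro n
  induction n using Nat.strong_induction_on with
  | _ n ih =>
    intro α M hMfin hn p q hpq
    rcases Nat.eq_zero_or_pos q with hq0 | hq1
    · subst hq0
      exact slack_nonneg_q_zero M p
    by_cases hnl : ∃ e, M.IsNonloop e
    · obtain ⟨e, he, hMC⟩ := h M p q hq1 hpq hnl
      refine le_trans ?_ hMC
      have heE : e ∈ M.E := he.mem_ground
      have hlt : (M ／ {e}).E.ncard < n := by
        rw [Matroid.contract_ground, ← hn]
        exact Set.ncard_sdiff_singleton_lt_of_mem heE M.ground_finite
      refine le_min ?_ ?_
      · by_cases hp : q + 2 ≤ p - 1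
        · exact ih _ hlt (M ／ {e}) rfl (p - 1) q hp
        · have hp' : p - 1 = q + 1 := by omega
          rw [hp']
          exact slack_succ_self_nonneg _ q
      · exact ih _ hlt (M ／ {e}) rfl (p - 1) (q - 1) (by omega)
    · have hloop : ∀ e ∈ M.E, M.IsLoop e := by
        intro e heE
        rcases M.isLoop_or_isNonloop e heE with hl | hnl'
        · exact hl
        · exact absurd ⟨e, hnl'⟩ hnl
      unfold slack
      rw [topCount_eq_zero_of_forall_isLoop M hloop (by omega) q]
      simp

/-- **C-025 FROM (MC-2)∃**: the two-cell contraction monotonicity at one non-loop per matroid implies the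
rank level-set inequality for every finite matroid and every `q + 2 ≤ p`. -/
theorem c025_of_contractMonoTwoExists (h : ContractMonoTwoExists) : C025 := by
  intro α M _ p q hpq
  rw [body_iff_slack_nonneg]
  exact slack_nonneg_of_contractMonoTwoExists h _ M rfl p q hpq

/-- **C-025 FROM (MC-2)** (the every-element form). -/
theorem c025_of_contractMonoTwo (h : ContractMonoTwo) : C025 :=
  c025_of_contractMonoTwoExists (contractMonoTwoExists_of_contractMonoTwo h)

end Matroid

end PercRepro
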